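import Literature.NumberTheory.DiophantineGeometry.FibreConductorKappaDefect
import HarnessLib

/-!
# The conductor slope, MIXED form: separation at a fixed set of bad places, defect at the others

Support lemma for the abc-iut cell's route item GenEllTwo (ledger `stmt-ABC-19679`; [GenEll] =
S. Mochizuki, *Arithmetic elliptic curves in general position*, Math. J. Okayama Univ. **52** (2010),
Thm. 2.1, proof pp. 12–13; cell work package W5, piece W5d).  Companion of
`FibreConductorKappa.lean` (bad places by `p`-adic SEPARATION, `hbad₁`) and
`FibreConductorKappaDefect.lean` (bad places by a DEFECT inequality, `hdef`/`hD`): the GenEllTwo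
design in which the separation places are FIXED IN ADVANCE (a finite set `S₁` of rational primes chosen
before the parameter menu, e.g. `{2} ∪ primes(2k+1)`), while every other bad place of the chosen
parameter is treated by the defect inequality (no separation there), needs the slope theorem with both
kinds of bad places at once.  This is a free corollary of the defect form — at a separation place take
the defect weight `D(w) := ord⁺_w(N)` — recorded here in the abstract form
(`inv_finrank_mul_sum_logNorm_le_slope_of_sep_of_defect`) and in the end-to-end rational-prime form
(`inv_finrank_mul_sum_logNorm_le_slope_of_prime_sep_of_prime_defect`: separation in EMBEDDING currency
`p^{−k_p} ≤ ‖σ N‖` at `p ∈ S₁`, per-prime defects `D_p·e_w` at `p ∈ S₂`; output = the `hκ` shape with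
`C₁ = Σ_{p∈S₁} k_p·log p + Σ_{p∈S₂} D_p·log p`, `C₂ = Σ_{p∈S₁} log p + Σ_{p∈S₂} log p`).
No definitions; classical; nothing here refers to the disputed parts of the abc-iut corpus.
[cite: MochizukiGenEll2010, Thm 2.1 proof pp.12-13] [cite: BombieriGubler2006, §2.3]
-/

noncomputable section

open NumberField IsDedekindDomain Height Real Finset
open Literature.IUT.LogVolume

namespace Literature.NumberTheory.DiophantineGeometry.FibreConductor

variable {L : Type*} [Field L] [NumberField L]

/-! ## Mixed form: separation at a FIXED set of places, defect at the others

Under the GenEllTwo design «Λ fixed before the menu» (separation of the point from the ramification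
locus only at the places over a finite set of rational primes fixed in advance, e.g. `{2} ∪ primes(2k+1)`;
at every other bad place the defect inequality), the slope theorem is needed with BOTH kinds of bad
places at once.  This is a free corollary of the defect form: at a separation place put
`D(w) := ord⁺_w(N)` (the defect inequality then holds trivially and its cost is the separation bound).
-/

/-- **The conductor slope, mixed form (`hκ` shape).**  Bad places `Ssep ∪ Sdef`; on `Ssep` the summed
separation bound `Σ_{w∈Ssep} ord⁺_w(N)·log N(w) ≤ n·C₁` (as in `inv_finrank_mul_sum_logNorm_le_slope`), on
`Sdef` the defect inequality with weights `D` and `Σ_{w∈Sdef} D(w)·log N(w) ≤ n·C₁'`; dichotomy pair and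
meeting property off `Ssep ∪ Sdef`.  Output: the `hκ` right-hand side with bad-place constant
`(C₁ + C₁') + C₂`. [cite: MochizukiGenEll2010, Thm 2.1 proof pp.12-13] -/
theorem inv_finrank_mul_sum_logNorm_le_slope_of_sep_of_defect [DecidableEq (HeightOneSpectrum (𝓞 L))] (k : ℕ) (x t N : L) (B : Finset L)
    (W Ssep Sdef : Finset (HeightOneSpectrum (𝓞 L))) (D : HeightOneSpectrum (𝓞 L) → ℕ)
    {C₁ C₁' C₂ C₃ C₄ C₅ C₆ : ℝ}
    (hplace : ∀ w : HeightOneSpectrum (𝓞 L), w ∉ Ssep ∪ Sdef →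
      ((∃ b ∈ B, 0 < ord L w (t - b)) → 1 + (ord L w N).toNat ≤ ∑ b ∈ B, (ord L w (t - b)).toNat) ∧
      ((¬ ∃ b ∈ B, 0 < ord L w (t - b)) → (ord L w N).toNat ≤ ∑ b ∈ B, (ord L w (t - b)).toNat))
    (hW : ∀ w ∈ W, w ∉ Ssep ∪ Sdef → ∃ b ∈ B, 0 < ord L w (t - b))
    (hsep : ∑ w ∈ Ssep, ((ord L w N).toNat : ℝ) * logNorm L w ≤ Module.finrank ℚ L * C₁)
    (hdef : ∀ w ∈ Sdef, (ord L w N).toNat ≤ (∑ b ∈ B, (ord L w (t - b)).toNat) + D w)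
    (hD : ∑ w ∈ Sdef, (D w : ℝ) * logNorm L w ≤ Module.finrank ℚ L * C₁')
    (hbad₂ : ∑ w ∈ Ssep ∪ Sdef, logNorm L w ≤ Module.finrank ℚ L * C₂)
    (harch : ∀ v : InfinitePlace L, log⁺ (v N⁻¹) ≤ C₃)
    (ht : (2 * k + 1 : ℝ) * logHeight₁ t ≤ (2 * k + 4 : ℝ) * logHeight₁ x + Module.finrank ℚ L * C₄)
    (hN : (6 * k + 6 : ℝ) * logHeight₁ x ≤ (2 * k + 1 : ℝ) * logHeight₁ N + Module.finrank ℚ L * C₅)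
    (hB : ∀ b ∈ B, logHeight₁ b ≤ Module.finrank ℚ L * C₆) :
    (Module.finrank ℚ L : ℝ)⁻¹ * ∑ w ∈ W, logNorm L w ≤
      ((B.card * (2 * k + 4 : ℝ) - (6 * k + 6)) / (2 * k + 1)) *
          ((Module.finrank ℚ L : ℝ)⁻¹ * logHeight₁ x) +
        ((B.card * C₄ + C₅) / (2 * k + 1) + B.card * (C₆ + Real.log 2) + (C₁ + C₁') + C₂ + C₃) := by
  -- total defect: the given one on `Sdef`, and `ord⁺_w(N)` itself on `Ssep`
  let D' : HeightOneSpectrum (𝓞 L) → ℕ := fun w =>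
    (if w ∈ Sdef then D w else 0) + (if w ∈ Ssep then (ord L w N).toNat else 0)
  have hdef' : ∀ w ∈ Ssep ∪ Sdef, (ord L w N).toNat ≤ (∑ b ∈ B, (ord L w (t - b)).toNat) + D' w := by
    intro w hw
    by_cases hd : w ∈ Sdef
    · have h := hdef w hd
      have hle : D w ≤ D' w := by simp only [D', if_pos hd]; omega
      omega
    · have hs : w ∈ Ssep := by
        rcases Finset.mem_union.mp hw with h | h
        · exact h
        · exact absurd h hd
      have hle : (ord L w N).toNat ≤ D' w := by simp only [D', if_pos hs]; omega
      omega
  have hD' : ∑ w ∈ Ssep ∪ Sdef, (D' w : ℝ) * logNorm L w ≤ Module.finrank ℚ L * (C₁ + C₁') := by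
    have hsplit : ∑ w ∈ Ssep ∪ Sdef, (D' w : ℝ) * logNorm L w =
        ∑ w ∈ Ssep ∪ Sdef, (if w ∈ Sdef then (D w : ℝ) * logNorm L w else 0) +
          ∑ w ∈ Ssep ∪ Sdef, (if w ∈ Ssep then ((ord L w N).toNat : ℝ) * logNorm L w else 0) := by
      rw [← Finset.sum_add_distrib]
      refine Finset.sum_congr rfl fun w _ => ?_
      simp only [D']
      split_ifs <;> push_cast <;> ring
    have h1 : ∑ w ∈ Ssep ∪ Sdef, (if w ∈ Sdef then (D w : ℝ) * logNorm L w else 0) =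
        ∑ w ∈ Sdef, (D w : ℝ) * logNorm L w := by
      rw [← Finset.sum_filter, Finset.filter_mem_eq_inter,
        Finset.inter_eq_right.mpr Finset.subset_union_right]
    have h2 : ∑ w ∈ Ssep ∪ Sdef, (if w ∈ Ssep then ((ord L w N).toNat : ℝ) * logNorm L w else 0) =
        ∑ w ∈ Ssep, ((ord L w N).toNat : ℝ) * logNorm L w := by
      rw [← Finset.sum_filter, Finset.filter_mem_eq_inter,
        Finset.inter_eq_right.mpr Finset.subset_union_left]
    rw [hsplit, h1, h2, mul_add]
    linarith
  have h := inv_finrank_mul_sum_logNorm_le_slope_of_dichotomy_of_defect k x t N B W (Ssep ∪ Sdef) D'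
    hplace hW hdef' hD' hbad₂ harch ht hN hB
  simpa only [add_assoc] using h

open scoped Classical in
/-- The separation sum over `⋃_{p∈S} {w ∣ p}` from EMBEDDING-currency separation at each `p ∈ S`
(`p^{−k_p} ≤ ‖σ N‖` for all `σ : L → ℚ̄_p`): `Σ_w ord⁺_w(N)·log N(w) ≤ [L:ℚ]·Σ_{p∈S} k_p·log p`
(the first half of `FibreConductor.sum_biUnion_placesOver_le`). [cite: MochizukiGenEll2010, Thm 2.1 proof pp.12-13] -/
theorem sum_biUnion_placesOver_toNat_ord_mul_logNorm_le (S : Finset ℕ) (hS : ∀ p ∈ S, p.Prime) {a : L}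
    (ha : a ≠ 0) (kp : ℕ → ℕ)
    (h : ∀ p ∈ S, ∀ [Fact p.Prime], ∀ σ : L →+* PadicAlgCl p, ((p : ℝ) ^ kp p)⁻¹ ≤ ‖σ a‖) :
    ∑ w ∈ S.attach.biUnion (fun p => placesOver L p.1), ((ord L w a).toNat : ℝ) * logNorm L w ≤
      (Module.finrank ℚ L : ℝ) * ∑ p ∈ S, (kp p : ℝ) * Real.log p := by
  rw [Finset.sum_biUnion (pairwiseDisjoint_placesOver S hS)]
  have h3 : ∀ p ∈ S.attach, ∑ w ∈ placesOver L p.1, ((ord L w a).toNat : ℝ) * logNorm L w ≤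
      (Module.finrank ℚ L : ℝ) * ((kp p.1 : ℝ) * Real.log p.1) := by
    intro p _
    haveI : Fact p.1.Prime := ⟨hS p.1 p.2⟩
    exact sum_placesOver_toNat_ord_mul_logNorm_le p.1 ha (kp p.1) (h p.1 p.2)
  calc ∑ p ∈ S.attach, ∑ w ∈ placesOver L p.1, ((ord L w a).toNat : ℝ) * logNorm L w
      ≤ ∑ p ∈ S.attach, (Module.finrank ℚ L : ℝ) * ((kp p.1 : ℝ) * Real.log p.1) := Finset.sum_le_sum h3
    _ = (Module.finrank ℚ L : ℝ) * ∑ p ∈ S, (kp p : ℝ) * Real.log p := by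
        rw [← Finset.mul_sum, Finset.sum_attach S (fun p => (kp p : ℝ) * Real.log (p : ℝ))]

open scoped Classical in
/-- **End-to-end, mixed form with rational-prime indexing (`hκ` shape).**  `S₁` = the separation primes
(fixed in advance; embedding-currency separation `p^{−k_p} ≤ ‖σ N‖`), `S₂` = the defect primes (per-prime
defects `D_p·e_w`, no separation); dichotomy pair and meeting property off the places over `S₁ ∪ S₂`;
archimedean separation and the three height inputs.  Then `hκ` holds with bad-place constants
`C₁ := Σ_{p∈S₁} k_p·log p + Σ_{p∈S₂} D_p·log p` and `C₂ := Σ_{p∈S₁∪S₂} log p`.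
[cite: MochizukiGenEll2010, Thm 2.1 proof pp.12-13] -/
theorem inv_finrank_mul_sum_logNorm_le_slope_of_prime_sep_of_prime_defect (k : ℕ) (x t N : L)
    (hN0 : N ≠ 0) (B : Finset L) (W : Finset (HeightOneSpectrum (𝓞 L))) (S₁ S₂ : Finset ℕ)
    (hS₁ : ∀ p ∈ S₁, p.Prime) (hS₂ : ∀ p ∈ S₂, p.Prime) (kp Dp : ℕ → ℕ) {C₃ C₄ C₅ C₆ : ℝ}
    (hplace : ∀ w : HeightOneSpectrum (𝓞 L),
      w ∉ S₁.attach.biUnion (fun p => placesOver L p.1) ∪ S₂.attach.biUnion (fun p => placesOver L p.1) →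
      ((∃ b ∈ B, 0 < ord L w (t - b)) → 1 + (ord L w N).toNat ≤ ∑ b ∈ B, (ord L w (t - b)).toNat) ∧
      ((¬ ∃ b ∈ B, 0 < ord L w (t - b)) → (ord L w N).toNat ≤ ∑ b ∈ B, (ord L w (t - b)).toNat))
    (hW : ∀ w ∈ W,
      w ∉ S₁.attach.biUnion (fun p => placesOver L p.1) ∪ S₂.attach.biUnion (fun p => placesOver L p.1) →
      ∃ b ∈ B, 0 < ord L w (t - b))
    (hsep : ∀ p ∈ S₁, ∀ [Fact p.Prime], ∀ σ : L →+* PadicAlgCl p, ((p : ℝ) ^ kp p)⁻¹ ≤ ‖σ N‖)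
    (hδ : ∀ p ∈ S₂, ∀ w ∈ placesOver L p,
      (ord L w N).toNat ≤ (∑ b ∈ B, (ord L w (t - b)).toNat) + Dp p * ramIdx L w)
    (harch : ∀ v : InfinitePlace L, log⁺ (v N⁻¹) ≤ C₃)
    (ht : (2 * k + 1 : ℝ) * logHeight₁ t ≤ (2 * k + 4 : ℝ) * logHeight₁ x + Module.finrank ℚ L * C₄)
    (hN : (6 * k + 6 : ℝ) * logHeight₁ x ≤ (2 * k + 1 : ℝ) * logHeight₁ N + Module.finrank ℚ L * C₅)
    (hB : ∀ b ∈ B, logHeight₁ b ≤ Module.finrank ℚ L * C₆) :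
    (Module.finrank ℚ L : ℝ)⁻¹ * ∑ w ∈ W, logNorm L w ≤
      ((B.card * (2 * k + 4 : ℝ) - (6 * k + 6)) / (2 * k + 1)) *
          ((Module.finrank ℚ L : ℝ)⁻¹ * logHeight₁ x) +
        ((B.card * C₄ + C₅) / (2 * k + 1) + B.card * (C₆ + Real.log 2) +
          ((∑ p ∈ S₁, (kp p : ℝ) * Real.log p) + (∑ p ∈ S₂, (Dp p : ℝ) * Real.log p)) +
          ((∑ p ∈ S₁, Real.log p) + (∑ p ∈ S₂, Real.log p)) + C₃) := by
  set Ssep := S₁.attach.biUnion (fun p => placesOver L p.1) with hSsep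
  set Sdef := S₂.attach.biUnion (fun p => placesOver L p.1) with hSdef
  let D : HeightOneSpectrum (𝓞 L) → ℕ := fun w => Dp (residueChar L w) * ramIdx L w
  have hdef : ∀ w ∈ Sdef, (ord L w N).toNat ≤ (∑ b ∈ B, (ord L w (t - b)).toNat) + D w := by
    intro w hw
    rw [hSdef, Finset.mem_biUnion] at hw
    obtain ⟨p, _, hwp⟩ := hw
    haveI : Fact p.1.Prime := ⟨hS₂ p.1 p.2⟩
    have hres : residueChar L w = p.1 := (mem_placesOver_iff_residueChar w).mp hwp
    simp only [D, hres]
    exact hδ p.1 p.2 w hwp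
  have hsep' : ∑ w ∈ Ssep, ((ord L w N).toNat : ℝ) * logNorm L w ≤
      Module.finrank ℚ L * ∑ p ∈ S₁, (kp p : ℝ) * Real.log p :=
    sum_biUnion_placesOver_toNat_ord_mul_logNorm_le S₁ hS₁ hN0 kp hsep
  have hD : ∑ w ∈ Sdef, (D w : ℝ) * logNorm L w ≤
      Module.finrank ℚ L * ∑ p ∈ S₂, (Dp p : ℝ) * Real.log p :=
    (sum_biUnion_placesOver_defect_eq S₂ hS₂ Dp).le
  -- `Σ_{Ssep ∪ Sdef} log N(w) ≤ Σ_{Ssep} + Σ_{Sdef}` (nonnegative terms)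
  have hbad₂ : ∑ w ∈ Ssep ∪ Sdef, logNorm L w ≤
      Module.finrank ℚ L * ((∑ p ∈ S₁, Real.log p) + (∑ p ∈ S₂, Real.log p)) := by
    have hu : ∑ w ∈ Ssep ∪ Sdef, logNorm L w ≤ ∑ w ∈ Ssep, logNorm L w + ∑ w ∈ Sdef, logNorm L w := by
      have e := Finset.sum_union_inter (s₁ := Ssep) (s₂ := Sdef) (f := fun w => logNorm L w)
      have hnn : 0 ≤ ∑ w ∈ Ssep ∩ Sdef, logNorm L w :=
        Finset.sum_nonneg fun w _ => (logNorm_pos L w).le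
      linarith
    have h1 := sum_biUnion_placesOver_logNorm_le (L := L) S₁ hS₁
    have h2 := sum_biUnion_placesOver_logNorm_le (L := L) S₂ hS₂
    rw [mul_add]
    linarith
  exact inv_finrank_mul_sum_logNorm_le_slope_of_sep_of_defect k x t N B W Ssep Sdef D hplace hW hsep'
    hdef hD hbad₂ harch ht hN hB

end Literature.NumberTheory.DiophantineGeometry.FibreConductor
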